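import Summits.SmoothPoincare4.SmoothPoincare4.Theses.SblfDescent

/-!
# Disproof of `SblfDescent.StepTwo` (crux stmt-SmoothPoincare4-18529) — cdisprove work file

`StepTwo` := for every smooth `M ≃ₕ S⁴`, `HAS M 1 → HAS M 0`, where `HAS M h` ("`M` admits a
simplified broken Lefschetz fibration of LOWER genus `h`": one indefinite fold circle with embedded
image, positive Lefschetz points on the genus-`h+1` side, connected regular fibres of genus `h+1` / `h`
read as `rank H₁ = 2(h+1)` / `2h`) is the inline predicate of the route file, named below
(`HASWith`, `HAS`; `stepTwo_iff` is `Iff.rfl`).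

## Findings (cycle 1, 2026-08-17)

1. **No unconditional kill exists short of `¬ SPC4`** (kernel-checked, § RefutationCost):
   `not_smoothPoincare4_of_not_stepTwo` — modulo the literature fact `hADK` ("every `M`
   diffeomorphic to `S⁴` carries a genus-1 SBLF": the Auroux–Donaldson–Katzarkov fibration of `S⁴`,
   Baykur–Kamada arXiv:1010.5814 Fig. genus_one_sblfs, transported; true, not yet formalised) a
   counterexample to `StepTwo` is an EXOTIC 4-sphere of broken genus 2
   (`isEmpty_diffeomorph_of_counterexample`).  Sandwich: the strongest hypothesis-free variant
   `∀ M ≃ₕ S⁴, HAS M 0` is already EQUIVALENT to `SmoothPoincare4` modulo `hADK` + `RungOne`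
   (`strongest_iff_smoothPoincare4`), and `¬ StepTwo` refutes it (`not_strongest_of_not_stepTwo`):
   every mutation of the SBLF hypothesis `HAS M 1` that keeps `M ≃ₕ S⁴` is refutable only by an
   exotic sphere.  Slice form (`stepTwo_iff_slice`): given `RungOne` + `hADK`,
   `StepTwo ⟺ "homotopy 4-spheres of broken genus ≤ 2 are standard"` — open in print
   (Baykur–Saeki arXiv:1710.06529 §6: "classified for g ≤ 1 … out of reach when g ≥ 2").
2. **Load-bearing hypothesis** (§ LoadBearing): the ONLY external hypothesis is `M ≃ₕ S⁴`, and it is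
   load-bearing IN PRINT: `ℂℙ²` has broken genus 2 (Baykur arXiv:1205.5439 Thm 18: genus-2 SBLF
   exists, `k = 5`; no genus-1 SBLF by Hayano arXiv:1012.4049), so `StepTwo` with `M ≃ₕ S⁴` deleted —
   or weakened to `SimplyConnectedSpace M` — is FALSE; `K3bar` (broken genus 2, spin, σ = 16) kills
   "simply connected ∧ spin".  Hence a proof must consume `H₂(M) = 0` / `σ(M) = 0` / `χ(M) = 2`
   (⇔ exactly four Lefschetz points), not merely `π₁ = 1`.  Weakening to "`ℤ`-homology 4-sphere":
   status unknown (no broken-genus computation for e.g. the spun Poincaré sphere found).  The formal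
   witness needs an explicit SBLF on `ℂℙ²`: near-miss `stepTwo_false_without_homotopySphere` (sorry).
3. **Natural strengthening refuted** (kernel-checked, § SameMap): "destabilise in place" is
   impossible — no single map `f : M → S²` witnesses both `HAS M 1` and `HAS M 0`
   (`not_sameMap`, from exclusivity of the genus reading `gen_unique`: `ℤ^{2n} ≃ ℤ^{2m} ⇒ n = m`;
   generally the lower genus is a FUNCTION OF THE MAP, `HASWith.lowerGenus_eq`, so every rung of the
   ladder must change `f`);
   the Lefschetz set of a witness lies in the critical set (`HASWith.not_regular_of_mem`); with
   `L = ∅` (forced in the conclusion on a homotopy sphere by `χ = 6 − 4g + k`) the orientation datum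
   is decoration (`HASWith.of_empty_orientation`); `Gen f y 0 ↔ H₁ = 0` (`gen_zero_iff`, no junk at
   genus 0).
4. **Formalisation audit — no junk found**: `singularHomology` is Mathlib's (honest `H₁`);
   `IsLefschetzCriticalPoint … true` = ∃ orientation-preserving node chart (`∃ o` makes "positive" =
   "all of one chirality", correct on a possibly chiral exotic `M`); the fold model
   `(t, x²+y²−z²)` covers index 1 and 2 (flip `ψ`); `InjOn f {crit}` = embedded round image + distinct
   critical values; `IsConnected ({crit} ∖ L)` = exactly one (non-empty) fold circle; `M ≃ₕ S⁴` forces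
   compact, closed, `π₁ = 1`; `Surjective f` excludes `M = ∅`; no `ℕ`-subtraction / division / `sSup`.
   `HAS` is insensitive to puncturing `M` at a regular point (`H₁` of a punctured surface has the same
   rank), harmless under `M ≃ₕ S⁴`.  Degenerate instances: none (`h = 0, 1` fixed; `L = ∅` allowed and
   forced in the conclusion).
5. **Finite / computational models**: none — every model of the binders is a smooth homotopy
   4-sphere; the `B₆` / `Sp(4,𝔽₂)` shadow censuses of the idea cards attack the METHOD (Hurwitz
   systems), and a Hurwitz-rigid system would kill the engine, not `StepTwo` (its total space is
   SPC4-hard).  No kit job submitted.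
6. **Literature kill criterion "genus-2 rung already known"** does not fire: arXiv full list
   "broken Lefschetz fibration" (29 papers, 2007–2025) read by title; Baykur–Saeki 2018 §6, Baykur
   1205.5439 Thm 18 / Rem 19, Baykur–Kamada 1010.5814, Hayano 1711.02790: genus-1 SBLFs classified,
   genus 2 not; a genus-2 SBLF with `k = 4`, `ℓ = 1` corresponds to a simplified trisection of genus
   `g' = 2g + k − ℓ + 2 = 9` (Baykur–Saeki Thm 3.2), outside Meier–Zupan (`g' ≤ 2`).

Landed from this file: `Theorems/StepTwo/Negative/RefutationCost.lean` (p146615 ACCEPTED,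
`not_smoothPoincare4_of_not_stepTwo`, `strongest_iff_smoothPoincare4`, `not_strongest_of_not_stepTwo`);
and `Theorems/StepTwo/Negative/SameMapObstruction.lean` (p148279 ACCEPTED; `genusReading_unique`,
`lowerGenus_unique`, `sameMap_lowerGenus_eq`, `not_destabilise_inPlace`, `not_sameMap_witness`).
Prior art used: refuter birth note 2026-08-17T05:08 (`stepTwo_of_SPC4`, `stepTwo_iff_slice`, the
ℤ²-gluing SHARPEN) — re-derived here in negative form; no earlier `Disproof.lean` existed.
-/

noncomputable section

-- the prescribed namespace `Summit.<P>.<Sub>.…` duplicates `SmoothPoincare4` (P = Sub)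
set_option linter.dupNamespace false

open scoped Manifold ContDiff Topology ContinuousMap
open Set Function

namespace Summit.SmoothPoincare4.SmoothPoincare4.Cruxes.StepTwo.Disproof

open Literature.Topology.FourManifolds Literature.AlgebraicTopology.SingularHomology
open Summit.SmoothPoincare4.SmoothPoincare4.Theses.SblfDescent

/-- Local notation: the standard 4-sphere. -/
local notation "𝕊⁴" => (Metric.sphere (0 : EuclideanSpace ℝ (Fin 5)) 1)
/-- Local notation: the standard 2-sphere (base of the fibrations). -/
local notation "𝕊²" => (Metric.sphere (0 : EuclideanSpace ℝ (Fin 3)) 1)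

/-! ## The inline predicate, named -/

section Predicates

variable {M : Type} [TopologicalSpace M] [ChartedSpace (EuclideanSpace ℝ (Fin 4)) M]

/-- The genus reading of the route file: the fibre over `y` has `H₁ ≅ ℤ^{2n}`. [folklore] -/
def Gen (f : M → 𝕊²) (y : 𝕊²) (n : ℕ) : Prop :=
  Nonempty ((Fin (2 * n) → ℤ) ≃ₗ[ℤ] singularHomology ℤ ℤ ↥(f ⁻¹' {y}) 1)

variable [IsManifold (𝓡 4) ∞ M]

/-- `HASWith o f L h`: VERBATIM body of the route's inline predicate — `(o, f, L)` is a simplified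
broken Lefschetz fibration of `M` over `S²` of lower genus `h` (higher genus `h + 1`), positive
Lefschetz set `L`, one indefinite fold circle. [folklore] -/
def HASWith (o : SmoothOrientation (𝓡 4) M) (f : M → 𝕊²) (L : Finset M) (h : ℕ) : Prop :=
  let R : M → Prop := fun q => Function.Surjective (mfderiv (𝓡 4) (𝓡 2) f q); let G : 𝕊² → ℕ → Prop := fun y n => Nonempty ((Fin (2 * n) → ℤ) ≃ₗ[ℤ] Literature.AlgebraicTopology.SingularHomology.singularHomology ℤ ℤ ↥(f ⁻¹' {y}) 1); ContMDiff (𝓡 4) (𝓡 2) ((⊤ : ℕ∞) : WithTop ℕ∞) f ∧ Function.Surjective f ∧ (∀ p ∈ L, Literature.Topology.FourManifolds.IsLefschetzCriticalPoint (𝓡 4) (𝓡 2) o f p true) ∧ (∀ p : M, ¬ R p → p ∉ L → ∃ (φ : OpenPartialHomeomorph M (EuclideanSpace ℝ (Fin 4))) (ψ : OpenPartialHomeomorph (Metric.sphere (0 : EuclideanSpace ℝ (Fin 3)) 1) (EuclideanSpace ℝ (Fin 2))), p ∈ φ.source ∧ φ p = 0 ∧ Set.MapsTo f φ.source ψ.source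 ∧ ContMDiffOn (𝓡 4) (𝓡 4) ((⊤ : ℕ∞) : WithTop ℕ∞) φ φ.source ∧ ContMDiffOn (𝓡 4) (𝓡 4) ((⊤ : ℕ∞) : WithTop ℕ∞) φ.symm φ.target ∧ ContMDiffOn (𝓡 2) (𝓡 2) ((⊤ : ℕ∞) : WithTop ℕ∞) ψ ψ.source ∧ ContMDiffOn (𝓡 2) (𝓡 2) ((⊤ : ℕ∞) : WithTop ℕ∞) ψ.symm ψ.target ∧ ∀ q ∈ φ.source, (ψ (f q)) 0 = (φ q) 0 ∧ (ψ (f q)) 1 = (φ q) 1 ^ 2 + (φ q) 2 ^ 2 - (φ q) 3 ^ 2) ∧ IsConnected ({p : M | ¬ R p} \ (↑L : Set M)) ∧ Set.InjOn f {p : M | ¬ R p} ∧ (∀ y, (∀ q, f q = y → R q) → IsConnected (f ⁻¹' {y}) ∧ (G y (h + 1) ∨ G y (h))) ∧ (∃ y, (∀ q, f q = y → R q) ∧ G y (h + 1)) ∧ (∃ y, (∀ q, f q = y → R q) ∧ G y (h)) ∧ (∀ p ∈ L, ∀ᶠ y in nhds (f p), (∀ q, f q = y → R q) → G y (h + 1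))

variable (M) in
/-- `HAS M h`: `M` admits a simplified broken Lefschetz fibration of lower genus `h` (the route's
inline `∃ o f L, …`). [folklore] -/
def HAS (h : ℕ) : Prop :=
  ∃ (o : SmoothOrientation (𝓡 4) M) (f : M → 𝕊²) (L : Finset M), HASWith o f L h

end Predicates

/-! ## Reading lemmas: the route items are literally `HAS`-statements -/

/-- `StepTwo` is `HAS M 1 → HAS M 0` on homotopy 4-spheres. [folklore] -/
theorem stepTwo_iff : StepTwo ↔
    ∀ (M : Type) [TopologicalSpace M] [T2Space M] [SecondCountableTopology M]
      [ChartedSpace (EuclideanSpace ℝ (Fin 4)) M] [IsManifold (𝓡 4) ∞ M],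
      M ≃ₕ 𝕊⁴ → HAS M 1 → HAS M 0 :=
  Iff.rfl

/-- `RungOne` is `HAS M 0 → M ≅ S⁴` on homotopy 4-spheres. [folklore] -/
theorem rungOne_iff : RungOne ↔
    ∀ (M : Type) [TopologicalSpace M] [T2Space M] [SecondCountableTopology M]
      [ChartedSpace (EuclideanSpace ℝ (Fin 4)) M] [IsManifold (𝓡 4) ∞ M],
      M ≃ₕ 𝕊⁴ → HAS M 0 → Nonempty (M ≃ₘ⟮𝓡 4, 𝓡 4⟯ 𝕊⁴) :=
  Iff.rfl

/-- `StepGE3` is `HAS M (h+1) → HAS M h` for `h ≥ 1` on homotopy 4-spheres. [folklore] -/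
theorem stepGE3_iff : StepGE3 ↔
    ∀ (M : Type) [TopologicalSpace M] [T2Space M] [SecondCountableTopology M]
      [ChartedSpace (EuclideanSpace ℝ (Fin 4)) M] [IsManifold (𝓡 4) ∞ M],
      M ≃ₕ 𝕊⁴ → ∀ h : ℕ, 1 ≤ h → HAS M (h + 1) → HAS M h :=
  Iff.rfl

/-- `SblfExists` is `∃ h, HAS M h` on homotopy 4-spheres. [folklore] -/
theorem sblfExists_iff : SblfExists ↔
    ∀ (M : Type) [TopologicalSpace M] [T2Space M] [SecondCountableTopology M]
      [ChartedSpace (EuclideanSpace ℝ (Fin 4)) M] [IsManifold (𝓡 4) ∞ M],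
      M ≃ₕ 𝕊⁴ → ∃ h : ℕ, HAS M h :=
  Iff.rfl

/-- **Counterexample normal form.** `StepTwo` fails iff some smooth homotopy 4-sphere has a
genus-2 SBLF (`HAS M 1`) and no genus-1 SBLF (`¬ HAS M 0`). [folklore] -/
theorem not_stepTwo_iff : ¬ StepTwo ↔
    ∃ (M : Type) (_ : TopologicalSpace M) (_ : T2Space M) (_ : SecondCountableTopology M)
      (_ : ChartedSpace (EuclideanSpace ℝ (Fin 4)) M) (_ : IsManifold (𝓡 4) ∞ M),
      Nonempty (M ≃ₕ 𝕊⁴) ∧ HAS M 1 ∧ ¬ HAS M 0 := by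
  rw [stepTwo_iff]
  constructor
  · intro h
    by_contra hne
    apply h
    intro M _ _ _ _ _ e h1
    by_contra h0
    exact hne ⟨M, ‹_›, ‹_›, ‹_›, ‹_›, ‹_›, ⟨e⟩, h1, h0⟩
  · rintro ⟨M, i₁, i₂, i₃, i₄, i₅, ⟨e⟩, h1, h0⟩ h
    exact h0 (@h M i₁ i₂ i₃ i₄ i₅ e h1)

/-! ## § RefutationCost — why no unconditional kill exists (finding 1) -/

section RefutationCost

/-- **Refutation cost.**  Modulo the literature fact `hADK` (every 4-manifold diffeomorphic to
`S⁴` carries a genus-1 simplified broken Lefschetz fibration: the Auroux–Donaldson–Katzarkov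
fibration of `S⁴`, transported along the diffeomorphism), `SmoothPoincare4` implies `StepTwo`
uniformly in the genus-2 datum; contrapositively a refutation of the crux is a refutation of the
summit. [folklore] -/
theorem not_smoothPoincare4_of_not_stepTwo
    (hADK : ∀ (M : Type) [TopologicalSpace M] [T2Space M] [SecondCountableTopology M]
      [ChartedSpace (EuclideanSpace ℝ (Fin 4)) M] [IsManifold (𝓡 4) ∞ M],
      Nonempty (M ≃ₘ⟮𝓡 4, 𝓡 4⟯ 𝕊⁴) → HAS M 0)
    (h : ¬ StepTwo) : ¬ _root_.SmoothPoincare4 := by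
  intro hs
  refine h ?_
  intro M _ _ _ _ _ e _
  exact hADK M (hs M inferInstance inferInstance e)

/-- **A counterexample is exotic.**  Modulo `hADK`, a homotopy 4-sphere without a genus-1 SBLF
(in particular the `M` of any counterexample to `StepTwo`, `not_stepTwo_iff`) is not
diffeomorphic to `S⁴`. [folklore] -/
theorem isEmpty_diffeomorph_of_not_has_zero
    (hADK : ∀ (M : Type) [TopologicalSpace M] [T2Space M] [SecondCountableTopology M]
      [ChartedSpace (EuclideanSpace ℝ (Fin 4)) M] [IsManifold (𝓡 4) ∞ M],
      Nonempty (M ≃ₘ⟮𝓡 4, 𝓡 4⟯ 𝕊⁴) → HAS M 0)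
    {M : Type} [TopologicalSpace M] [T2Space M] [SecondCountableTopology M]
    [ChartedSpace (EuclideanSpace ℝ (Fin 4)) M] [IsManifold (𝓡 4) ∞ M]
    (h0 : ¬ HAS M 0) : IsEmpty (M ≃ₘ⟮𝓡 4, 𝓡 4⟯ 𝕊⁴) :=
  ⟨fun d => h0 (hADK M ⟨d⟩)⟩

/-- **The strongest variant is the summit.**  Delete the WHOLE hypothesis `HAS M 1` (every
mutation of the SBLF datum is weaker than this): "every smooth homotopy 4-sphere carries a genus-1
SBLF" is equivalent to `SmoothPoincare4`, modulo `hADK` (`←`) and the route's own support `RungOne`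
(Hayano / Baykur–Kamada, `→`). [folklore] -/
theorem strongest_iff_smoothPoincare4
    (hADK : ∀ (M : Type) [TopologicalSpace M] [T2Space M] [SecondCountableTopology M]
      [ChartedSpace (EuclideanSpace ℝ (Fin 4)) M] [IsManifold (𝓡 4) ∞ M],
      Nonempty (M ≃ₘ⟮𝓡 4, 𝓡 4⟯ 𝕊⁴) → HAS M 0)
    (hR : RungOne) :
    (∀ (M : Type) [TopologicalSpace M] [T2Space M] [SecondCountableTopology M]
      [ChartedSpace (EuclideanSpace ℝ (Fin 4)) M] [IsManifold (𝓡 4) ∞ M],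
      M ≃ₕ 𝕊⁴ → HAS M 0) ↔ _root_.SmoothPoincare4 := by
  constructor
  · intro h M _ _ _ _ _ e
    exact hR M e (h M e)
  · intro hs M _ _ _ _ _ e
    exact hADK M (hs M inferInstance inferInstance e)

/-- The strongest variant implies the crux (trivially), so … [folklore] -/
theorem stepTwo_of_strongest
    (h : ∀ (M : Type) [TopologicalSpace M] [T2Space M] [SecondCountableTopology M]
      [ChartedSpace (EuclideanSpace ℝ (Fin 4)) M] [IsManifold (𝓡 4) ∞ M],
      M ≃ₕ 𝕊⁴ → HAS M 0) : StepTwo :=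
  fun M _ _ _ _ _ e _ => h M e

/-- … **sandwich**: `¬ StepTwo` refutes the strongest variant too; with
`strongest_iff_smoothPoincare4`, every "`StepTwo` minus a conjunct of `HAS M 1`" (achiral
Lefschetz points, several fold circles, disconnected fibres, immersed round image, Lefschetz points on
either side, any genus bound …) is refutable only by an exotic 4-sphere. [folklore] -/
theorem not_strongest_of_not_stepTwo (h : ¬ StepTwo) :
    ¬ ∀ (M : Type) [TopologicalSpace M] [T2Space M] [SecondCountableTopology M]
      [ChartedSpace (EuclideanSpace ℝ (Fin 4)) M] [IsManifold (𝓡 4) ∞ M],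
      M ≃ₕ 𝕊⁴ → HAS M 0 :=
  fun hs => h (stepTwo_of_strongest hs)

/-- **Slice form** (the precise open problem the crux is): given `RungOne` and `hADK`, `StepTwo`
holds iff every smooth homotopy 4-sphere admitting a genus-2 simplified broken Lefschetz fibration
is diffeomorphic to `S⁴` ("homotopy 4-spheres of broken genus ≤ 2 are standard").  Not in print:
Baykur–Saeki 2018 §6. [folklore] -/
theorem stepTwo_iff_slice
    (hADK : ∀ (M : Type) [TopologicalSpace M] [T2Space M] [SecondCountableTopology M]
      [ChartedSpace (EuclideanSpace ℝ (Fin 4)) M] [IsManifold (𝓡 4) ∞ M],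
      Nonempty (M ≃ₘ⟮𝓡 4, 𝓡 4⟯ 𝕊⁴) → HAS M 0)
    (hR : RungOne) :
    StepTwo ↔ ∀ (M : Type) [TopologicalSpace M] [T2Space M] [SecondCountableTopology M]
      [ChartedSpace (EuclideanSpace ℝ (Fin 4)) M] [IsManifold (𝓡 4) ∞ M],
      M ≃ₕ 𝕊⁴ → HAS M 1 → Nonempty (M ≃ₘ⟮𝓡 4, 𝓡 4⟯ 𝕊⁴) := by
  constructor
  · intro h M _ _ _ _ _ e h1
    exact hR M e (h M e h1)
  · intro h M _ _ _ _ _ e h1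
    exact hADK M (h M e h1)

end RefutationCost

/-! ## § SameMap — the natural strengthening "destabilise in place" is false (finding 3) -/

section SameMap

variable {M : Type} [TopologicalSpace M]

/-- **The genus reading is exclusive**: `ℤ^{2n} ≃ H₁(F) ≃ ℤ^{2m}` forces `n = m` (invariant basis
number of `ℤ`), so the disjunction "genus `h+1` or `h`" in `HAS` is a genuine dichotomy of the
regular values. [folklore] -/
theorem gen_unique {f : M → 𝕊²} {y : 𝕊²} {n m : ℕ} (hn : Gen f y n) (hm : Gen f y m) : n = m := by
  obtain ⟨e₁⟩ := hn
  obtain ⟨e₂⟩ := hm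
  have h := (e₁.trans e₂.symm).finrank_eq
  simp only [Module.finrank_fin_fun] at h
  omega

/-- **Genus 0 is read honestly**: `Gen f y 0` says exactly that `H₁` of the fibre is trivial (no
junk from `Fin 0`). [folklore] -/
theorem gen_zero_iff {f : M → 𝕊²} {y : 𝕊²} :
    Gen f y 0 ↔ Subsingleton (singularHomology ℤ ℤ ↥(f ⁻¹' {y}) 1) := by
  change Nonempty ((Fin 0 → ℤ) ≃ₗ[ℤ] _) ↔ _
  constructor
  · rintro ⟨e⟩
    exact e.symm.toEquiv.subsingleton
  · intro _
    exact ⟨LinearEquiv.ofSubsingleton _ _⟩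

variable [ChartedSpace (EuclideanSpace ℝ (Fin 4)) M] [IsManifold (𝓡 4) ∞ M]

/-- **Lefschetz points of a witness are critical points**: `dπ_p = 0` at a point with a node chart
(`IsLefschetzCriticalPoint.mfderiv_eq_zero`), and `0 : ℝ⁴ → ℝ²` is not onto; so in `HASWith o f L h`
the set `L` lies inside `{p | ¬ R p}` and `{p | ¬ R p} = fold locus ⊔ L`. [folklore] -/
theorem HASWith.not_regular_of_mem {o : SmoothOrientation (𝓡 4) M} {f : M → 𝕊²} {L : Finset M}
    {h : ℕ} (hH : HASWith o f L h) {p : M} (hp : p ∈ L) :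
    ¬ Function.Surjective (mfderiv (𝓡 4) (𝓡 2) f p) := by
  obtain ⟨c, -⟩ := hH.2.2.1 p hp
  rw [c.mfderiv_eq_zero]
  intro hs
  obtain ⟨v, hv⟩ := hs (EuclideanSpace.single (0 : Fin 2) (1 : ℝ))
  have h0 : (EuclideanSpace.single (0 : Fin 2) (1 : ℝ) : EuclideanSpace ℝ (Fin 2)) = 0 := by
    rw [← hv]
    rfl
  have h1 := congrArg (fun w : EuclideanSpace ℝ (Fin 2) => w 0) h0
  simp at h1

/-- **No destabilisation in place.**  One map `f : M → S²` cannot witness both `HAS M 1` and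
`HAS M 0` (whatever the orientations and Lefschetz sets): `HAS M 1` provides a regular value with
fibre of genus 2 (`H₁ ≅ ℤ⁴`), while `HAS M 0` reads every regular fibre of the SAME map as a torus or
a sphere.  Any proof of `StepTwo` must construct a new fibration map. [folklore] -/
theorem not_sameMap {o o' : SmoothOrientation (𝓡 4) M} {f : M → 𝕊²} {L L' : Finset M}
    (h1 : HASWith o f L 1) (h0 : HASWith o' f L' 0) : False := by
  obtain ⟨y, hy, hG⟩ := h1.2.2.2.2.2.2.2.1
  obtain ⟨-, hG'⟩ := h0.2.2.2.2.2.2.1 y hy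
  rcases hG' with h01 | h00
  · have := gen_unique hG h01; omega
  · have := gen_unique hG h00; omega

/-- Corollary: the two rungs are never witnessed by a common triple `(o, f, L)`. [folklore] -/
theorem not_hasWith_one_and_zero (o : SmoothOrientation (𝓡 4) M) (f : M → 𝕊²) (L : Finset M) :
    ¬ (HASWith o f L 1 ∧ HASWith o f L 0) :=
  fun h => not_sameMap h.1 h.2

/-- **The lower genus is a function of the map** (generalises `not_sameMap` to every rung of the
ladder, `StepGE3` included): SBLF data of lower genera `h` and `h'` over ONE map `f` force `h = h'`
(cross the two "∃ higher-genus regular value" conjuncts with the two fibre dichotomies). [folklore] -/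
theorem HASWith.lowerGenus_eq {o o' : SmoothOrientation (𝓡 4) M} {f : M → 𝕊²} {L L' : Finset M}
    {h h' : ℕ} (hh : HASWith o f L h) (hh' : HASWith o' f L' h') : h = h' := by
  obtain ⟨y, hy, hG⟩ := hh.2.2.2.2.2.2.2.1
  obtain ⟨y', hy', hG'⟩ := hh'.2.2.2.2.2.2.2.1
  obtain ⟨-, ha | hb⟩ := hh'.2.2.2.2.2.2.1 y hy
  · have := gen_unique hG ha; omega
  · have h₁ := gen_unique hG hb
    obtain ⟨-, hc | hd⟩ := hh.2.2.2.2.2.2.1 y' hy'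
    · have := gen_unique hG' hc; omega
    · have := gen_unique hG' hd; omega

/-- **Without Lefschetz points the orientation is decoration**: `o` enters `HASWith` only through
the chirality of the points of `L`; in the conclusion `HAS M 0` on a homotopy sphere `L = ∅` is
forced (`χ = 6 − 4g + k` with `g = 1`), so there the `∃ o` carries no content. [folklore] -/
theorem HASWith.of_empty_orientation {o : SmoothOrientation (𝓡 4) M} (o' : SmoothOrientation (𝓡 4) M)
    {f : M → 𝕊²} {h : ℕ} (hH : HASWith o f ∅ h) : HASWith o' f ∅ h := by
  obtain ⟨h1, h2, -, h4, h5, h6, h7, h8, h9, -⟩ := hH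
  exact ⟨h1, h2, fun p hp => absurd hp (Finset.notMem_empty p), h4, h5, h6, h7, h8, h9,
    fun p hp => absurd hp (Finset.notMem_empty p)⟩

/-- Changing the orientation only re-tests the chirality of `L`. [folklore] -/
theorem HASWith.of_orientation {o : SmoothOrientation (𝓡 4) M} (o' : SmoothOrientation (𝓡 4) M)
    {f : M → 𝕊²} {L : Finset M} {h : ℕ} (hH : HASWith o f L h)
    (hL : ∀ p ∈ L, IsLefschetzCriticalPoint (𝓡 4) (𝓡 2) o' f p true) : HASWith o' f L h := by
  obtain ⟨h1, h2, -, h4, h5, h6, h7, h8, h9, h10⟩ := hH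
  exact ⟨h1, h2, hL, h4, h5, h6, h7, h8, h9, h10⟩

end SameMap

/-! ## § LoadBearing — the homotopy-sphere hypothesis (finding 2) -/

section LoadBearing

/-- **NEAR-MISS (not closable in the tree today).**  `StepTwo` with its only external hypothesis
`M ≃ₕ S⁴` deleted is FALSE in print: `ℂℙ²` admits a genus-2 simplified broken Lefschetz fibration
(Hayano–Sato arXiv:1110.0161 Thm 1.5, p. 3: "for each `n ≥ 0`, `#n ℂℙ²` admits a genus-2 simplified
broken Lefschetz fibration"; five positive Lefschetz points by `χ = 6 − 4g + k`; the round locus is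
non-empty since no honest Lefschetz fibration lives on a definite manifold; cf. Baykur
arXiv:1205.5439 Thm 18 "`#m ℂℙ²` has broken genus two") but NO genus-1 SBLF (Hayano arXiv:1012.4049,
quoted ibid. p. 3: "a simply connected four-manifold with a positive definite intersection form cannot
admit any genus-1 simplified broken Lefschetz fibration except `S⁴`"), i.e.
`HAS ℂℙ² 1 ∧ ¬ HAS ℂℙ² 0`.  The same witness kills the
weakening of `M ≃ₕ S⁴` to `SimplyConnectedSpace M`; `K3bar` (broken genus 2, Thm 18) kills
"simply connected ∧ spin".  OBSTRUCTION: the tree has `ℂℙ²` as a smooth 4-manifold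
(`Literature.Topology.FourManifolds.ComplexProjectiveSpace…`) but no explicit SBLF on it — the
witness needs the map `f`, its fold/node charts and `H₁` of its fibres (XL); and Hayano's genus-1
classification is not vendored.  Tried: nothing cheaper exists — junk inhabitants of the binders
(`Empty`, `ℝ⁴` with a submersion) fail `HAS M 1` (surjectivity onto `S²` / non-empty fold locus).
[cite: arXiv:1205.5439, Thm 18] -/
theorem stepTwo_false_without_homotopySphere :
    ¬ ∀ (M : Type) [TopologicalSpace M] [T2Space M] [SecondCountableTopology M]
        [ChartedSpace (EuclideanSpace ℝ (Fin 4)) M] [IsManifold (𝓡 4) ∞ M],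
        HAS M 1 → HAS M 0 := by
  sorry

/-- What the deleted hypothesis buys, in the form a prover can cite: under `M ≃ₕ S⁴` the variant
above IS the crux. [folklore] -/
theorem stepTwo_of_without_homotopySphere
    (h : ∀ (M : Type) [TopologicalSpace M] [T2Space M] [SecondCountableTopology M]
        [ChartedSpace (EuclideanSpace ℝ (Fin 4)) M] [IsManifold (𝓡 4) ∞ M],
        HAS M 1 → HAS M 0) : StepTwo :=
  fun M _ _ _ _ _ _ h1 => h M h1

end LoadBearing

-- Targets: none yet (payload.targets = [], no line picked; the birth skeleton's stubs
-- `stub_count : L.card = 4` / `stub_descend` are not registered).  On re-arm: attack the picked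
-- line's stubs (K1 "unknotted lower fibre on S⁴" of montesinos-torus-surgery-rigidity is NOT
-- shielded — a genus-2 SBLF on S⁴ with knotted lower torus kills it; DCP normal form of
-- signature-pin-cable-push is testable on Hayano's flip-and-slip systems).

end Summit.SmoothPoincare4.SmoothPoincare4.Cruxes.StepTwo.Disproof

end
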